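import Literature.Geometry.Lorentzian.CoordBoundaryCoercivityPointwise
import Literature.Geometry.Lorentzian.CoordWeightedKornBoundary
import Literature.Geometry.Lorentzian.CoordWeightedHessianBoundary
import Literature.Geometry.Lorentzian.CoordWeightedKornGradient
import HarnessLib

/-!
# Integral bookkeeping for the boundary coercivity estimate (Chruściel–Delay 2003, (3.4) at ∂M)

Topic `Literature/Geometry/Lorentzian`, coordinate tensor calculus `MetricCoord` (Riemannian metric
components `G` on an open set `V`, a boundary defining function `x` smooth on `V`, the collar
`{0 < x < x₀}`). Everything here is PROVED; no definition and no statement of `Prop` type is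
introduced.

The integrated forms, in the common weight `e = e^{2σ/x}`, of the pointwise bounds of
`CoordBoundaryCoercivityPointwise.lean` and of the bricks (5.12) (`CoordWeightedKornBoundary`),
Prop. C.4 (`CoordWeightedPoincareBoundary`), the Hessian estimate (`CoordWeightedHessianBoundary`)
and the weighted Korn inequality (`CoordWeightedKornGradient`), for fields `N, Y` smooth on `V`
with compact support in the collar — the eight inequalities between the quantities
`∫e|Y|²`, `∫eN²`, `∫e x⁴|∇N|²`, `∫e x⁸|Hess N|²`, `∫e x⁴|R_K|²`, `∫e x⁸|R_G|²`, `∫e x⁴|T|²`,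
`∫e x⁴|∇Y|²`, `∫e x⁸|M|²`, `∫e x⁴|S(Y)|²` that are combined in `CoordBoundaryCoercivity.lean`
(`R_K = adjHamK N + adjMomKS Y`, `R_G = adjHamG N + adjMomGS Y`, `T = S(Y) + ½(div Y)G`,
`M = adjMomGS Y`).

## References

* P. T. Chruściel, E. Delay, Mém. Soc. Math. Fr. 94 (2003), §3 (3.4), proof of Thm. 5.9, (5.10),
  (5.12), App. C Prop. C.4. [ChruscielDelay2003]
-/

noncomputable section

set_option maxSynthPendingDepth 3

open Set Filter Module Function MeasureTheory
open scoped Topology ContDiff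

namespace Literature.Geometry.Lorentzian

namespace MetricCoord

variable {E : Type*} [NormedAddCommGroup E] [NormedSpace ℝ E] [FiniteDimensional ℝ E]
  [CompleteSpace E] {ι : Type*} [Fintype ι] [DecidableEq ι] (b : Basis ι ℝ E)
  {G : E → E →L[ℝ] E →L[ℝ] ℝ} {V : Set E} {K : E → E →L[ℝ] E →L[ℝ] ℝ} {xf : E → ℝ}
  {N : E → ℝ} {Y : E → E}

/-! ### Smoothness of the rows -/

omit [Fintype ι] [DecidableEq ι] in
/-- The `κ`-row `adjHamK N` of smooth data is smooth. [folklore] -/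
theorem IsMetricOn.contDiffOn_adjHamK (hG : IsMetricOn G V) (hK : ContDiffOn ℝ ∞ K V)
    (hN : ContDiffOn ℝ ∞ N V) : ContDiffOn ℝ ∞ (adjHamK G K N) V := by
  have h : adjHamK G K N = fun y ↦ -(2 * N y) • K y + (2 * N y * mtrAt G y (K y)) • G y := rfl
  rw [h]
  exact ((contDiffOn_const.mul hN).neg.smul hK).add
    (((contDiffOn_const.mul hN).mul (hG.contDiffOn_mtrAt hK)).smul hG.contDiffOn)

omit [Fintype ι] [DecidableEq ι] in
/-- The `γ`-row `adjHamG N` of smooth data is smooth. [folklore] -/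
theorem IsMetricOn.contDiffOn_adjHamG (hG : IsMetricOn G V) (hK : ContDiffOn ℝ ∞ K V)
    (hN : ContDiffOn ℝ ∞ N V) : ContDiffOn ℝ ∞ (adjHamG G K N) V := by
  have h : adjHamG G K N = fun y ↦ (-(lapAt G N y) • G y + hessAt G N y - N y • ricAt G y)
      + (2 * N y) • (K y).comp ((sharpAt G y).comp (K y))
      - (2 * N y * mtrAt G y (K y)) • K y := rfl
  rw [h]
  have h1 : ContDiffOn ℝ ∞ (fun y ↦ -(lapAt G N y) • G y + hessAt G N y - N y • ricAt G y) V :=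
    (((hG.contDiffOn_lapAt hN).neg.smul hG.contDiffOn).add (hG.contDiffOn_hessAt hN)).sub
      (hN.smul hG.contDiffOn_ricAt)
  have h2 : ContDiffOn ℝ ∞ (fun y ↦ (2 * N y) • (K y).comp ((sharpAt G y).comp (K y))) V :=
    (contDiffOn_const.mul hN).smul (hK.clm_comp (hG.contDiffOn_sharpAt.clm_comp hK))
  have h3 : ContDiffOn ℝ ∞ (fun y ↦ (2 * N y * mtrAt G y (K y)) • K y) V :=
    ((contDiffOn_const.mul hN).mul (hG.contDiffOn_mtrAt hK)).smul hK
  exact (h1.add h2).sub h3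

/-! ### The collar -/

section Collar

variable [MeasurableSpace E] [BorelSpace E] (μ : Measure E) [μ.IsAddHaarMeasure]

omit [FiniteDimensional ℝ E] [CompleteSpace E] [Fintype ι] [DecidableEq ι] [MeasurableSpace E] [BorelSpace E] in
/-- The open collar `{y ∈ V | 0 < x < x₁}` carries the restricted metric components. [folklore] -/
theorem IsMetricOn.collar (hG : IsMetricOn G V) (hxf : ContDiffOn ℝ ∞ xf V) (x₁ : ℝ) :
    IsMetricOn G {y ∈ V | 0 < xf y ∧ xf y < x₁} := by
  have ho : IsOpen {y ∈ V | 0 < xf y ∧ xf y < x₁} := by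
    have : {y ∈ V | 0 < xf y ∧ xf y < x₁} = V ∩ xf ⁻¹' Ioo 0 x₁ := by
      ext y; simp only [Set.mem_setOf_eq, Set.mem_inter_iff, Set.mem_preimage, Set.mem_Ioo]
    rw [this]
    exact hxf.continuousOn.isOpen_inter_preimage hG.isOpen isOpen_Ioo
  exact ⟨ho, hG.contDiffOn.mono fun y hy ↦ hy.1, fun y hy ↦ hG.symm y hy.1,
    fun y hy ↦ hG.isInvertible y hy.1⟩

omit [FiniteDimensional ℝ E] [CompleteSpace E] [Fintype ι] [DecidableEq ι] [MeasurableSpace E] [BorelSpace E] in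
/-- The weight `e^{2σ/x}` is smooth on the collar. [folklore] -/
theorem contDiffOn_expWeight_collar (hxf : ContDiffOn ℝ ∞ xf V) (σ x₁ : ℝ) :
    ContDiffOn ℝ ∞ (fun y ↦ Real.exp (2 * σ / xf y)) {y ∈ V | 0 < xf y ∧ xf y < x₁} := by
  have hxf' : ContDiffOn ℝ ∞ xf {y ∈ V | 0 < xf y ∧ xf y < x₁} := hxf.mono fun y hy ↦ hy.1
  have h : ContDiffOn ℝ ∞ (fun y ↦ (xf y)⁻¹) {y ∈ V | 0 < xf y ∧ xf y < x₁} :=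
    hxf'.inv fun y hy ↦ hy.2.1.ne'
  have h2 : ContDiffOn ℝ ∞ (fun y ↦ 2 * σ / xf y) {y ∈ V | 0 < xf y ∧ xf y < x₁} :=
    ((contDiffOn_const (c := 2 * σ)).mul h).congr fun y _ ↦ by simp only [div_eq_mul_inv]
  exact h2.exp

omit [FiniteDimensional ℝ E] [CompleteSpace E] in
/-- **Integrability on the collar**: for a compact closed `S` inside the collar and `k` smooth on
the collar vanishing off `S`, `√det g · k` is integrable. [folklore] -/
theorem IsMetricOn.integrable_collar (hG : IsMetricOn G V)
    (hpos : ∀ y ∈ V, ∀ e : E, e ≠ 0 → 0 < G y e e) (hxf : ContDiffOn ℝ ∞ xf V) {x₁ : ℝ}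
    {S : Set E} (hS : IsCompact S) (hSc : IsClosed S) (hSV : S ⊆ {y ∈ V | 0 < xf y ∧ xf y < x₁})
    {k : E → ℝ} (hk : ContDiffOn ℝ ∞ k {y ∈ V | 0 < xf y ∧ xf y < x₁}) (hk0 : ∀ z ∉ S, k z = 0) :
    Integrable (fun z ↦ sqrtDetGram G b z * k z) μ :=
  (hG.collar hxf x₁).integrable_sqrtDetGram_mul_of_subset b μ (fun y hy ↦ hpos y hy.1) hS hSc hSV
    hk hk0

/-! ### From pointwise to integral inequalities -/

omit [FiniteDimensional ℝ E] [CompleteSpace E] [BorelSpace E] [μ.IsAddHaarMeasure] in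
/-- Integrating a pointwise inequality `f ≤ a₁g₁ + a₂g₂ + a₃g₃` valid on a set off which all four
functions vanish, against the density `√det g ≥ 0`. [folklore] -/
theorem integral_sqrtDetGram_le_of_pointwise₃ {f g₁ g₂ g₃ : E → ℝ} (S : Set E) (a₁ a₂ a₃ : ℝ)
    (hf : Integrable (fun z ↦ sqrtDetGram G b z * f z) μ)
    (hg₁ : Integrable (fun z ↦ sqrtDetGram G b z * g₁ z) μ)
    (hg₂ : Integrable (fun z ↦ sqrtDetGram G b z * g₂ z) μ)
    (hg₃ : Integrable (fun z ↦ sqrtDetGram G b z * g₃ z) μ)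
    (hpt : ∀ y ∈ S, f y ≤ a₁ * g₁ y + a₂ * g₂ y + a₃ * g₃ y)
    (h0 : ∀ y ∉ S, f y = 0 ∧ g₁ y = 0 ∧ g₂ y = 0 ∧ g₃ y = 0) :
    ∫ y, sqrtDetGram G b y * f y ∂μ ≤
      a₁ * ∫ y, sqrtDetGram G b y * g₁ y ∂μ + a₂ * ∫ y, sqrtDetGram G b y * g₂ y ∂μ
        + a₃ * ∫ y, sqrtDetGram G b y * g₃ y ∂μ := by
  have hI : Integrable (fun y ↦ a₁ * (sqrtDetGram G b y * g₁ y) + a₂ * (sqrtDetGram G b y * g₂ y)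
      + a₃ * (sqrtDetGram G b y * g₃ y)) μ :=
    ((hg₁.const_mul a₁).add (hg₂.const_mul a₂)).add (hg₃.const_mul a₃)
  have hmono : ∫ y, sqrtDetGram G b y * f y ∂μ ≤
      ∫ y, a₁ * (sqrtDetGram G b y * g₁ y) + a₂ * (sqrtDetGram G b y * g₂ y)
        + a₃ * (sqrtDetGram G b y * g₃ y) ∂μ := by
    refine integral_mono hf hI fun y ↦ ?_
    show sqrtDetGram G b y * f y ≤ a₁ * (sqrtDetGram G b y * g₁ y) + a₂ * (sqrtDetGram G b y * g₂ y)
      + a₃ * (sqrtDetGram G b y * g₃ y)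
    by_cases hy : y ∈ S
    · have h := mul_le_mul_of_nonneg_left (hpt y hy) (Real.sqrt_nonneg (gramMatrix G b y).det)
      calc sqrtDetGram G b y * f y ≤ sqrtDetGram G b y * (a₁ * g₁ y + a₂ * g₂ y + a₃ * g₃ y) := h
        _ = _ := by ring
    · obtain ⟨h1, h2, h3, h4⟩ := h0 y hy
      rw [h1, h2, h3, h4]; simp
  have hI₁₂ : Integrable (fun y ↦ a₁ * (sqrtDetGram G b y * g₁ y) + a₂ * (sqrtDetGram G b y * g₂ y)) μ :=
    (hg₁.const_mul a₁).add (hg₂.const_mul a₂)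
  rw [integral_add hI₁₂ (hg₃.const_mul a₃), integral_add (hg₁.const_mul a₁) (hg₂.const_mul a₂),
    integral_const_mul, integral_const_mul, integral_const_mul] at hmono
  exact hmono

/-! ### The collar setting: supports, vanishing, positivity -/

omit [NormedSpace ℝ E] [FiniteDimensional ℝ E] [CompleteSpace E] [Fintype ι] [DecidableEq ι] [MeasurableSpace E] [BorelSpace E] in
/-- Off `tsupport N ∪ tsupport Y` the fields vanish identically near the point. [folklore] -/
theorem eventuallyEq_zero_of_notMem_union {y : E} (hy : y ∉ tsupport N ∪ tsupport Y) :
    (N =ᶠ[𝓝 y] fun _ ↦ 0) ∧ (Y =ᶠ[𝓝 y] fun _ ↦ 0) :=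
  ⟨notMem_tsupport_iff_eventuallyEq.mp fun h ↦ hy (Or.inl h),
    notMem_tsupport_iff_eventuallyEq.mp fun h ↦ hy (Or.inr h)⟩

/-- Powers of the defining function on the collar `{0 < x < x₀}`, `x₀ ≤ 1`: `0 ≤ x⁴, x⁸`,
`x⁴ ≤ x₀`, `x⁸ ≤ x₀`, `x⁴ ≤ 1`. [folklore] -/
theorem collar_pow_bounds {X x₀ : ℝ} (hX : 0 < X) (hXx : X < x₀) (hx₀ : x₀ ≤ 1) :
    0 ≤ X ^ 4 ∧ 0 ≤ X ^ 8 ∧ X ^ 4 ≤ x₀ ∧ X ^ 8 ≤ x₀ ∧ X ^ 4 ≤ 1 := by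
  have hX1 : X ≤ 1 := hXx.le.trans hx₀
  have h4 : X ^ 4 ≤ X := pow_le_of_le_one hX.le hX1 (by norm_num)
  have h8 : X ^ 8 ≤ X := pow_le_of_le_one hX.le hX1 (by norm_num)
  exact ⟨by positivity, by positivity, h4.trans hXx.le, h8.trans hXx.le, h4.trans hX1⟩

/-! ### (II) `∫e x⁴|T|² ≤ c_n ∫e x⁴|R_K|² + 3x₀w₁ ∫eN²` -/

/-- **(II)** For `N, Y` smooth on `V` with compact support in the collar `{0 < x < x₀}`
(`x₀ ≤ min 1 x₁`) and `|tr K G + 2K|² ≤ w₁` on `{0 < x < x₁}`: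
`∫ √g e^{2σ/x} x⁴|T|² ≤ c_n ∫ √g e^{2σ/x} x⁴|R_K|² + 3x₀w₁ ∫ √g e^{2σ/x} N²`
(`T = S(Y) + ½(div Y)G`, `R_K = adjHamK N + adjMomKS Y`, `c_n = 3 + 3(3/(2(n−1)))²n²`).
[cite: ChruscielDelay2003, Thm. 5.9 (proof)] -/
theorem IsMetricOn.integral_kidT_le (hG : IsMetricOn G V)
    (hpos : ∀ y ∈ V, ∀ e : E, e ≠ 0 → 0 < G y e e) (hn : finrank ℝ E ≠ 1)
    (hK : ContDiffOn ℝ ∞ K V) (hxf : ContDiffOn ℝ ∞ xf V) {x₁ x₀ w₁ : ℝ} (σ : ℝ)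
    (hx₀1 : x₀ ≤ 1) (hx₀x₁ : x₀ ≤ x₁)
    (hW : ∀ y ∈ V, 0 < xf y → xf y < x₁ → normSqAt G y (mtrAt G y (K y) • G y + (2 : ℝ) • K y) ≤ w₁)
    (hN : ContDiffOn ℝ ∞ N V) (hY : ContDiffOn ℝ ∞ Y V) (hNs : HasCompactSupport N)
    (hYs : HasCompactSupport Y) (hNS : tsupport N ⊆ {y ∈ V | 0 < xf y ∧ xf y < x₀})
    (hYS : tsupport Y ⊆ {y ∈ V | 0 < xf y ∧ xf y < x₀}) :
    ∫ y, sqrtDetGram G b y * (Real.exp (2 * σ / xf y) * xf y ^ 4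
        * normSqAt G y (symAt ((G y).comp (covDAt G Y y)) + (2⁻¹ * divAt G Y y) • G y)) ∂μ ≤
      (3 + 3 * (3 / (2 * ((finrank ℝ E : ℝ) - 1))) ^ 2 * (finrank ℝ E : ℝ) ^ 2)
          * ∫ y, sqrtDetGram G b y * (Real.exp (2 * σ / xf y) * xf y ^ 4
              * normSqAt G y (adjHamK G K N y + adjMomKS G Y y)) ∂μ
        + 3 * (x₀ * w₁) * ∫ y, sqrtDetGram G b y * (Real.exp (2 * σ / xf y) * N y ^ 2) ∂μ := by
  -- the collar and the support
  set W : Set E := {y ∈ V | 0 < xf y ∧ xf y < x₁} with hWdef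
  have hGW : IsMetricOn G W := hG.collar hxf x₁
  set S : Set E := tsupport N ∪ tsupport Y with hSdef
  have hS : IsCompact S := hNs.union hYs
  have hSc : IsClosed S := (isClosed_tsupport N).union (isClosed_tsupport Y)
  have hSx₀ : S ⊆ {y ∈ V | 0 < xf y ∧ xf y < x₀} := union_subset hNS hYS
  have hSW : S ⊆ W := fun y hy ↦ ⟨(hSx₀ hy).1, (hSx₀ hy).2.1, (hSx₀ hy).2.2.trans_le hx₀x₁⟩
  have hWV : W ⊆ V := fun y hy ↦ hy.1
  have hNW := hN.mono hWV
  have hYW := hY.mono hWV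
  have hKW := hK.mono hWV
  have hE := contDiffOn_expWeight_collar (V := V) hxf σ x₁
  have hx4 : ContDiffOn ℝ ∞ (fun y ↦ xf y ^ 4) W := (hxf.mono hWV).pow 4
  -- smoothness of the three integrands on the collar
  have hT : ContDiffOn ℝ ∞ (fun y ↦ normSqAt G y (symAt ((G y).comp (covDAt G Y y))
      + (2⁻¹ * divAt G Y y) • G y)) W :=
    hGW.contDiffOn_normSqAt ((contDiffOn_symAt (hGW.contDiffOn.clm_comp (hGW.contDiffOn_covDAt hYW))).add
      ((contDiffOn_const.mul (hGW.contDiffOn_divAt hYW)).smul hGW.contDiffOn))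
  have hR : ContDiffOn ℝ ∞ (fun y ↦ normSqAt G y (adjHamK G K N y + adjMomKS G Y y)) W :=
    hGW.contDiffOn_normSqAt ((hGW.contDiffOn_adjHamK hKW hNW).add (hGW.contDiffOn_adjMomKS hYW))
  -- vanishing off the support
  have h0 : ∀ z ∉ S, normSqAt G z (symAt ((G z).comp (covDAt G Y z)) + (2⁻¹ * divAt G Y z) • G z) = 0
      ∧ normSqAt G z (adjHamK G K N z + adjMomKS G Y z) = 0 ∧ N z = 0 := by
    intro z hz
    obtain ⟨hNz, hYz⟩ := eventuallyEq_zero_of_notMem_union hz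
    obtain ⟨hRK, -, hcov, hdiv, -, -, hN0, -⟩ :=
      kidRows_eq_zero_of_eventuallyEq (G := G) (K := K) hNz hYz
    have hs0 : symAt (0 : E →L[ℝ] E →L[ℝ] ℝ) = 0 := by ext v w; simp [symAt_apply]
    refine ⟨?_, by simp [hRK, normSqAt_eq_traceCLM], hN0⟩
    rw [hcov, hdiv, ContinuousLinearMap.comp_zero, hs0, mul_zero, zero_smul, add_zero]
    simp [normSqAt_eq_traceCLM]
  have hf := hG.integrable_collar b μ hpos hxf hS hSc hSW ((hE.mul hx4).mul hT) fun z hz ↦ by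
    rw [(h0 z hz).1, mul_zero]
  have hg₁ := hG.integrable_collar b μ hpos hxf hS hSc hSW ((hE.mul hx4).mul hR) fun z hz ↦ by
    rw [(h0 z hz).2.1, mul_zero]
  have hg₂ := hG.integrable_collar b μ hpos hxf hS hSc hSW (hE.mul (hNW.pow 2)) fun z hz ↦ by
    rw [(h0 z hz).2.2]; simp
  have hg₃ : Integrable (fun z ↦ sqrtDetGram G b z * (fun _ ↦ (0 : ℝ)) z) μ := by
    simp
  -- integrate the pointwise bound
  have h := integral_sqrtDetGram_le_of_pointwise₃ b μ S
    (3 + 3 * (3 / (2 * ((finrank ℝ E : ℝ) - 1))) ^ 2 * (finrank ℝ E : ℝ) ^ 2) (3 * (x₀ * w₁)) 0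
    hf hg₁ hg₂ hg₃ (fun y hy ↦ ?_) (fun y hy ↦ ?_)
  · simpa only [zero_mul, add_zero] using h
  · obtain ⟨hyV, hx, hxx₀⟩ := hSx₀ hy
    obtain ⟨h4, -, h4x, -, -⟩ := collar_pow_bounds hx hxx₀ hx₀1
    have hpt := kidT_weighted_le (K := K) (N := N) (Y := Y) (e := Real.exp (2 * σ / xf y)) hG hyV
      (hpos y hyV) hn (Real.exp_pos _).le h4 h4x (hW y hyV hx (hxx₀.trans_le hx₀x₁))
    simpa only [mul_zero, add_zero] using hpt
  · obtain ⟨h1, h2, h3⟩ := h0 y hy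
    simp [h1, h2, h3]

/-! ### (V) `∫e x⁸|Hess N|² ≤ a_n ∫e x⁸|R_G|² + 3x₀z₁ ∫eN² + a_n ∫e x⁸|M|²` -/

/-- **(V)** For `N, Y` smooth on `V` with compact support in the collar `{0 < x < x₀}`
(`x₀ ≤ min 1 x₁`) and `|Z|² ≤ z₁` on `{0 < x < x₁}` (`Z` as in `kidRowG_recovery`):
`∫ √g e x⁸|Hess N|² ≤ a_n ∫ √g e x⁸|R_G|² + 3x₀z₁ ∫ √g e N² + a_n ∫ √g e x⁸|M|²`
(`e = e^{2σ/x}`, `R_G = adjHamG N + adjMomGS Y`, `M = adjMomGS Y`, `a_n = 6(1 + (n−1)⁻²n²)`).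
[cite: ChruscielDelay2003, Thm. 5.9 (proof)] -/
theorem IsMetricOn.integral_hessAt_le (hG : IsMetricOn G V)
    (hpos : ∀ y ∈ V, ∀ e : E, e ≠ 0 → 0 < G y e e) (hn : finrank ℝ E ≠ 1)
    (hK : ContDiffOn ℝ ∞ K V) (hxf : ContDiffOn ℝ ∞ xf V) {x₁ x₀ z₁ : ℝ} (σ : ℝ)
    (hx₀1 : x₀ ≤ 1) (hx₀x₁ : x₀ ≤ x₁)
    (hZ : ∀ y ∈ V, 0 < xf y → xf y < x₁ →
      normSqAt G y (ricAt G y - (2 : ℝ) • (K y).comp ((sharpAt G y).comp (K y))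
        + (2 * mtrAt G y (K y)) • K y
        + (((finrank ℝ E : ℝ) - 1)⁻¹ * (-scalAt G y
            + 2 * mtrAt G y ((K y).comp ((sharpAt G y).comp (K y)))
            - 2 * mtrAt G y (K y) ^ 2)) • G y) ≤ z₁)
    (hN : ContDiffOn ℝ ∞ N V) (hY : ContDiffOn ℝ ∞ Y V) (hNs : HasCompactSupport N)
    (hYs : HasCompactSupport Y) (hNS : tsupport N ⊆ {y ∈ V | 0 < xf y ∧ xf y < x₀})
    (hYS : tsupport Y ⊆ {y ∈ V | 0 < xf y ∧ xf y < x₀}) :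
    ∫ y, sqrtDetGram G b y * (Real.exp (2 * σ / xf y) * xf y ^ 8
        * normSqAt G y (hessAt G N y)) ∂μ ≤
      6 * (1 + (((finrank ℝ E : ℝ) - 1)⁻¹) ^ 2 * (finrank ℝ E : ℝ) ^ 2)
          * ∫ y, sqrtDetGram G b y * (Real.exp (2 * σ / xf y) * xf y ^ 8
              * normSqAt G y (adjHamG G K N y + adjMomGS G K Y y)) ∂μ
        + 3 * (x₀ * z₁) * ∫ y, sqrtDetGram G b y * (Real.exp (2 * σ / xf y) * N y ^ 2) ∂μ
        + 6 * (1 + (((finrank ℝ E : ℝ) - 1)⁻¹) ^ 2 * (finrank ℝ E : ℝ) ^ 2)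
          * ∫ y, sqrtDetGram G b y * (Real.exp (2 * σ / xf y) * xf y ^ 8
              * normSqAt G y (adjMomGS G K Y y)) ∂μ := by
  set W : Set E := {y ∈ V | 0 < xf y ∧ xf y < x₁} with hWdef
  have hGW : IsMetricOn G W := hG.collar hxf x₁
  set S : Set E := tsupport N ∪ tsupport Y with hSdef
  have hS : IsCompact S := hNs.union hYs
  have hSc : IsClosed S := (isClosed_tsupport N).union (isClosed_tsupport Y)
  have hSx₀ : S ⊆ {y ∈ V | 0 < xf y ∧ xf y < x₀} := union_subset hNS hYS
  have hSW : S ⊆ W := fun y hy ↦ ⟨(hSx₀ hy).1, (hSx₀ hy).2.1, (hSx₀ hy).2.2.trans_le hx₀x₁⟩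
  have hWV : W ⊆ V := fun y hy ↦ hy.1
  have hNW := hN.mono hWV
  have hYW := hY.mono hWV
  have hKW := hK.mono hWV
  have hE := contDiffOn_expWeight_collar (V := V) hxf σ x₁
  have hx8 : ContDiffOn ℝ ∞ (fun y ↦ xf y ^ 8) W := (hxf.mono hWV).pow 8
  have hH : ContDiffOn ℝ ∞ (fun y ↦ normSqAt G y (hessAt G N y)) W :=
    hGW.contDiffOn_normSqAt (hGW.contDiffOn_hessAt hNW)
  have hR : ContDiffOn ℝ ∞ (fun y ↦ normSqAt G y (adjHamG G K N y + adjMomGS G K Y y)) W :=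
    hGW.contDiffOn_normSqAt ((hGW.contDiffOn_adjHamG hKW hNW).add (hGW.contDiffOn_adjMomGS hKW hYW))
  have hM : ContDiffOn ℝ ∞ (fun y ↦ normSqAt G y (adjMomGS G K Y y)) W :=
    hGW.contDiffOn_normSqAt (hGW.contDiffOn_adjMomGS hKW hYW)
  -- vanishing off the support
  have h0 : ∀ z ∉ S, normSqAt G z (hessAt G N z) = 0 ∧
      normSqAt G z (adjHamG G K N z + adjMomGS G K Y z) = 0 ∧ N z = 0 ∧
      normSqAt G z (adjMomGS G K Y z) = 0 := by
    intro z hz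
    obtain ⟨hNz, hYz⟩ := eventuallyEq_zero_of_notMem_union hz
    obtain ⟨-, hRG, -, -, hhess, -, hN0, -⟩ :=
      kidRows_eq_zero_of_eventuallyEq (G := G) (K := K) hNz hYz
    have hM0 : adjMomGS G K Y z = 0 := by
      rw [adjMomGS_congr_of_eventuallyEq (EventuallyEq.rfl (f := G)) (EventuallyEq.rfl (f := K)) hYz]
      exact adjMomGS_zero_field
    exact ⟨by simp [hhess, normSqAt_eq_traceCLM], by simp [hRG, normSqAt_eq_traceCLM], hN0,
      by simp [hM0, normSqAt_eq_traceCLM]⟩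
  have hf := hG.integrable_collar b μ hpos hxf hS hSc hSW ((hE.mul hx8).mul hH) fun z hz ↦ by
    rw [(h0 z hz).1, mul_zero]
  have hg₁ := hG.integrable_collar b μ hpos hxf hS hSc hSW ((hE.mul hx8).mul hR) fun z hz ↦ by
    rw [(h0 z hz).2.1, mul_zero]
  have hg₂ := hG.integrable_collar b μ hpos hxf hS hSc hSW (hE.mul (hNW.pow 2)) fun z hz ↦ by
    rw [(h0 z hz).2.2.1]; simp
  have hg₃ := hG.integrable_collar b μ hpos hxf hS hSc hSW ((hE.mul hx8).mul hM) fun z hz ↦ by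
    rw [(h0 z hz).2.2.2, mul_zero]
  have h := integral_sqrtDetGram_le_of_pointwise₃ b μ S
    (6 * (1 + (((finrank ℝ E : ℝ) - 1)⁻¹) ^ 2 * (finrank ℝ E : ℝ) ^ 2)) (3 * (x₀ * z₁))
    (6 * (1 + (((finrank ℝ E : ℝ) - 1)⁻¹) ^ 2 * (finrank ℝ E : ℝ) ^ 2))
    hf hg₁ hg₂ hg₃ (fun y hy ↦ ?_) (fun y hy ↦ ?_)
  · exact h
  · obtain ⟨hyV, hx, hxx₀⟩ := hSx₀ hy
    obtain ⟨-, h8, -, h8x, -⟩ := collar_pow_bounds hx hxx₀ hx₀1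
    exact hessAt_weighted_le (K := K) (N := N) (Y := Y) (e := Real.exp (2 * σ / xf y)) hG hyV
      (hpos y hyV) hn (Real.exp_pos _).le h8 h8x (hZ y hyV hx (hxx₀.trans_le hx₀x₁))
  · obtain ⟨h1, h2, h3, h4⟩ := h0 y hy
    simp [h1, h2, h3, h4]

/-! ### (VI) `∫e x⁸|M|² ≤ (4+3n)x₀k₁ ∫e x⁴|∇Y|² + (1+2n²)x₀k₂ ∫e|Y|²` -/

/-- **(VI)** For `Y` smooth on `V` with compact support in the collar `{0 < x < x₀}`
(`x₀ ≤ min 1 x₁`) and `|K|² ≤ k₁`, `|∇K|² ≤ k₂` on `{0 < x < x₁}`: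
`∫ √g e x⁸|M|² ≤ (4+3n)x₀k₁ ∫ √g e x⁴|∇Y|² + (1+2n²)x₀k₂ ∫ √g e|Y|²`
(`M = adjMomGS Y`, `|∇Y|² = tr_G G(∇Y,∇Y)`). [cite: ChruscielDelay2003, Thm. 5.9 with (5.10c)] -/
theorem IsMetricOn.integral_adjMomGS_le (hG : IsMetricOn G V)
    (hpos : ∀ y ∈ V, ∀ e : E, e ≠ 0 → 0 < G y e e)
    (hK : ContDiffOn ℝ ∞ K V) (hKs : ∀ y ∈ V, ∀ v w, K y v w = K y w v)
    (hxf : ContDiffOn ℝ ∞ xf V) {x₁ x₀ k₁ k₂ : ℝ} (σ : ℝ) (hx₀1 : x₀ ≤ 1) (hx₀x₁ : x₀ ≤ x₁)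
    (hKn : ∀ y ∈ V, 0 < xf y → xf y < x₁ → normSqAt G y (K y) ≤ k₁)
    (hcov : ∀ y ∈ V, 0 < xf y → xf y < x₁ →
      ∑ k, ∑ l, ginv G b y k l * pairAt G y (cov₂At G K y (b k)) (cov₂At G K y (b l)) ≤ k₂)
    (hY : ContDiffOn ℝ ∞ Y V) (hYs : HasCompactSupport Y)
    (hYS : tsupport Y ⊆ {y ∈ V | 0 < xf y ∧ xf y < x₀}) :
    ∫ y, sqrtDetGram G b y * (Real.exp (2 * σ / xf y) * xf y ^ 8
        * normSqAt G y (adjMomGS G K Y y)) ∂μ ≤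
      (4 + 3 * finrank ℝ E) * (x₀ * k₁)
          * ∫ y, sqrtDetGram G b y * (Real.exp (2 * σ / xf y) * xf y ^ 4
              * mtrAt G y ((G y).bilinearComp (covDAt G Y y) (covDAt G Y y))) ∂μ
        + (1 + 2 * (finrank ℝ E : ℝ) ^ 2) * (x₀ * k₂)
          * ∫ y, sqrtDetGram G b y * (Real.exp (2 * σ / xf y) * G y (Y y) (Y y)) ∂μ := by
  set W : Set E := {y ∈ V | 0 < xf y ∧ xf y < x₁} with hWdef
  have hGW : IsMetricOn G W := hG.collar hxf x₁
  set S : Set E := tsupport Y with hSdef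
  have hS : IsCompact S := hYs
  have hSc : IsClosed S := isClosed_tsupport Y
  have hSW : S ⊆ W := fun y hy ↦ ⟨(hYS hy).1, (hYS hy).2.1, (hYS hy).2.2.trans_le hx₀x₁⟩
  have hWV : W ⊆ V := fun y hy ↦ hy.1
  have hYW := hY.mono hWV
  have hKW := hK.mono hWV
  have hE := contDiffOn_expWeight_collar (V := V) hxf σ x₁
  have hx8 : ContDiffOn ℝ ∞ (fun y ↦ xf y ^ 8) W := (hxf.mono hWV).pow 8
  have hx4 : ContDiffOn ℝ ∞ (fun y ↦ xf y ^ 4) W := (hxf.mono hWV).pow 4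
  have hM : ContDiffOn ℝ ∞ (fun y ↦ normSqAt G y (adjMomGS G K Y y)) W :=
    hGW.contDiffOn_normSqAt (hGW.contDiffOn_adjMomGS hKW hYW)
  have hA : ContDiffOn ℝ ∞ (covDAt G Y) W := hGW.contDiffOn_covDAt hYW
  have hQ : ContDiffOn ℝ ∞ (fun y ↦ mtrAt G y ((G y).bilinearComp (covDAt G Y y) (covDAt G Y y))) W := by
    have heq : (fun y ↦ mtrAt G y ((G y).bilinearComp (covDAt G Y y) (covDAt G Y y))) =
        fun y ↦ ∑ i, ∑ j, ginv G b y i j * G y (covDAt G Y y (b i)) (covDAt G Y y (b j)) := by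
      funext y
      rw [mtrAt_eq_sum b]
      simp only [ContinuousLinearMap.bilinearComp_apply]
    rw [heq]
    refine ContDiffOn.sum fun i _ ↦ ContDiffOn.sum fun j _ ↦ ?_
    exact (hGW.contDiffOn_ginv b i j).mul
      ((hGW.contDiffOn.clm_apply (hA.clm_apply contDiffOn_const)).clm_apply
        (hA.clm_apply contDiffOn_const))
  have hnY : ContDiffOn ℝ ∞ (fun y ↦ G y (Y y) (Y y)) W := (hGW.contDiffOn.clm_apply hYW).clm_apply hYW
  -- vanishing off the support
  have h0 : ∀ z ∉ S, normSqAt G z (adjMomGS G K Y z) = 0 ∧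
      mtrAt G z ((G z).bilinearComp (covDAt G Y z) (covDAt G Y z)) = 0 ∧ G z (Y z) (Y z) = 0 := by
    intro z hz
    have hYz : Y =ᶠ[𝓝 z] fun _ ↦ 0 := notMem_tsupport_iff_eventuallyEq.mp hz
    have hNz : (fun _ : E ↦ (0 : ℝ)) =ᶠ[𝓝 z] fun _ ↦ 0 := EventuallyEq.rfl
    obtain ⟨-, -, hcov, -, -, -, -, hY0⟩ :=
      kidRows_eq_zero_of_eventuallyEq (G := G) (K := K) hNz hYz
    have hM0 : adjMomGS G K Y z = 0 := by
      rw [adjMomGS_congr_of_eventuallyEq (EventuallyEq.rfl (f := G)) (EventuallyEq.rfl (f := K)) hYz]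
      exact adjMomGS_zero_field
    refine ⟨by simp [hM0, normSqAt_eq_traceCLM], ?_, by simp [hY0]⟩
    rw [hcov, mtrAt_eq_sum b]
    simp
  have hf := hG.integrable_collar b μ hpos hxf hS hSc hSW ((hE.mul hx8).mul hM) fun z hz ↦ by
    rw [(h0 z hz).1, mul_zero]
  have hg₁ := hG.integrable_collar b μ hpos hxf hS hSc hSW ((hE.mul hx4).mul hQ) fun z hz ↦ by
    rw [(h0 z hz).2.1, mul_zero]
  have hg₂ := hG.integrable_collar b μ hpos hxf hS hSc hSW (hE.mul hnY) fun z hz ↦ by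
    rw [(h0 z hz).2.2, mul_zero]
  have hg₃ : Integrable (fun z ↦ sqrtDetGram G b z * (fun _ ↦ (0 : ℝ)) z) μ := by simp
  have h := integral_sqrtDetGram_le_of_pointwise₃ b μ S ((4 + 3 * finrank ℝ E) * (x₀ * k₁))
    ((1 + 2 * (finrank ℝ E : ℝ) ^ 2) * (x₀ * k₂)) 0 hf hg₁ hg₂ hg₃ (fun y hy ↦ ?_) (fun y hy ↦ ?_)
  · simpa only [zero_mul, add_zero] using h
  · obtain ⟨hyV, hx, hxx₀⟩ := hYS hy
    obtain ⟨h4, -, h4x, h8x, -⟩ := collar_pow_bounds hx hxx₀ hx₀1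
    have hxx₁ := hxx₀.trans_le hx₀x₁
    have hpt := adjMomGS_weighted_le b (e := Real.exp (2 * σ / xf y)) hG hyV (hpos y hyV) hK hKs hY
      (Real.exp_pos _).le h4 h4x h8x (hKn y hyV hx hxx₁) (hcov y hyV hx hxx₁)
    simpa only [mul_zero, add_zero] using hpt
  · obtain ⟨h1, h2, h3⟩ := h0 y hy
    simp [h1, h2, h3]

/-! ### (VIII) `∫e x⁴|S(Y)|² ≤ s_n ∫e x⁴|T|²` -/

/-- **(VIII)** For `Y` smooth on `V` with compact support in the collar:
`∫ √g e x⁴|S(Y)|² ≤ (2 + n²/2) ∫ √g e x⁴|T|²` (`T = S(Y) + ½(div Y)G`).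
[cite: ChruscielDelay2003, Thm. 5.9 (proof)] -/
theorem IsMetricOn.integral_symAt_le (hG : IsMetricOn G V)
    (hpos : ∀ y ∈ V, ∀ e : E, e ≠ 0 → 0 < G y e e)
    (hxf : ContDiffOn ℝ ∞ xf V) {x₁ x₀ : ℝ} (σ : ℝ) (hx₀x₁ : x₀ ≤ x₁)
    (hY : ContDiffOn ℝ ∞ Y V) (hYs : HasCompactSupport Y)
    (hYS : tsupport Y ⊆ {y ∈ V | 0 < xf y ∧ xf y < x₀}) :
    ∫ y, sqrtDetGram G b y * (Real.exp (2 * σ / xf y) * xf y ^ 4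
        * normSqAt G y (symAt ((G y).comp (covDAt G Y y)))) ∂μ ≤
      (2 + (finrank ℝ E : ℝ) ^ 2 / 2)
        * ∫ y, sqrtDetGram G b y * (Real.exp (2 * σ / xf y) * xf y ^ 4
            * normSqAt G y (symAt ((G y).comp (covDAt G Y y)) + (2⁻¹ * divAt G Y y) • G y)) ∂μ := by
  set W : Set E := {y ∈ V | 0 < xf y ∧ xf y < x₁} with hWdef
  have hGW : IsMetricOn G W := hG.collar hxf x₁
  set S : Set E := tsupport Y with hSdef
  have hS : IsCompact S := hYs
  have hSc : IsClosed S := isClosed_tsupport Y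
  have hSW : S ⊆ W := fun y hy ↦ ⟨(hYS hy).1, (hYS hy).2.1, (hYS hy).2.2.trans_le hx₀x₁⟩
  have hWV : W ⊆ V := fun y hy ↦ hy.1
  have hYW := hY.mono hWV
  have hE := contDiffOn_expWeight_collar (V := V) hxf σ x₁
  have hx4 : ContDiffOn ℝ ∞ (fun y ↦ xf y ^ 4) W := (hxf.mono hWV).pow 4
  have hSy : ContDiffOn ℝ ∞ (fun y ↦ normSqAt G y (symAt ((G y).comp (covDAt G Y y)))) W :=
    hGW.contDiffOn_normSqAt (contDiffOn_symAt (hGW.contDiffOn.clm_comp (hGW.contDiffOn_covDAt hYW)))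
  have hT : ContDiffOn ℝ ∞ (fun y ↦ normSqAt G y (symAt ((G y).comp (covDAt G Y y))
      + (2⁻¹ * divAt G Y y) • G y)) W :=
    hGW.contDiffOn_normSqAt ((contDiffOn_symAt (hGW.contDiffOn.clm_comp (hGW.contDiffOn_covDAt hYW))).add
      ((contDiffOn_const.mul (hGW.contDiffOn_divAt hYW)).smul hGW.contDiffOn))
  have h0 : ∀ z ∉ S, normSqAt G z (symAt ((G z).comp (covDAt G Y z))) = 0 ∧
      normSqAt G z (symAt ((G z).comp (covDAt G Y z)) + (2⁻¹ * divAt G Y z) • G z) = 0 := by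
    intro z hz
    have hYz : Y =ᶠ[𝓝 z] fun _ ↦ 0 := notMem_tsupport_iff_eventuallyEq.mp hz
    have hNz : (fun _ : E ↦ (0 : ℝ)) =ᶠ[𝓝 z] fun _ ↦ 0 := EventuallyEq.rfl
    obtain ⟨-, -, hcov, hdiv, -⟩ :=
      kidRows_eq_zero_of_eventuallyEq (G := G) (K := fun _ ↦ (0 : E →L[ℝ] E →L[ℝ] ℝ)) hNz hYz
    have hs0 : symAt (0 : E →L[ℝ] E →L[ℝ] ℝ) = 0 := by ext v w; simp [symAt_apply]
    rw [hcov, hdiv, ContinuousLinearMap.comp_zero, hs0, mul_zero, zero_smul, add_zero]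
    simp [normSqAt_eq_traceCLM]
  have hf := hG.integrable_collar b μ hpos hxf hS hSc hSW ((hE.mul hx4).mul hSy) fun z hz ↦ by
    rw [(h0 z hz).1, mul_zero]
  have hg₁ := hG.integrable_collar b μ hpos hxf hS hSc hSW ((hE.mul hx4).mul hT) fun z hz ↦ by
    rw [(h0 z hz).2, mul_zero]
  have hg₃ : Integrable (fun z ↦ sqrtDetGram G b z * (fun _ ↦ (0 : ℝ)) z) μ := by simp
  have h := integral_sqrtDetGram_le_of_pointwise₃ b μ S ((2 + (finrank ℝ E : ℝ) ^ 2 / 2)) 0 0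
    hf hg₁ hg₃ hg₃ (fun y hy ↦ ?_) (fun y hy ↦ ?_)
  · simpa only [zero_mul, add_zero] using h
  · obtain ⟨hyV, hx, -⟩ := hYS hy
    have hpt := normSqAt_symAt_covDAt_le_kidT (Y := Y) hG hyV (hpos y hyV)
    have hw : 0 ≤ Real.exp (2 * σ / xf y) * xf y ^ 4 := by positivity
    have := mul_le_mul_of_nonneg_left hpt hw
    simp only [mul_zero, add_zero]
    linarith
  · obtain ⟨h1, h2⟩ := h0 y hy
    simp [h1, h2]

/-! ### The weight conversions -/

omit [Fintype ι] [DecidableEq ι] [MeasurableSpace E] [BorelSpace E] in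
/-- `e^{2(−(−σ)/x + 2 log x)} = e^{2σ/x} x⁴` for `x > 0`. [folklore] -/
theorem cdWeight_negneg_eq (σ : ℝ) {r : ℝ} (hr : 0 < r) :
    Real.exp (2 * (-(-σ) / r + 2 * Real.log r)) = Real.exp (2 * σ / r) * r ^ 4 := by
  rw [neg_neg]; exact cdWeight_exp_eq σ hr

/-! ### (III) `(σ²m/2) ∫eN² ≤ ∫e x⁴|∇N|²` -/

/-- **(III)** (Prop. C.4 with `u = N`, `s = −σ`, `t = 2`, `ε = σ²/2`): if `m ≤ |∇x|²` and
`|Δx| ≤ M` on `{0 < x < x₁}`, then there is `x₂ > 0` such that for `x₀ ≤ min x₂ x₁` and every `N`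
smooth on `V` with compact support in `{0 < x < x₀}`,
`(σ²m/2) ∫ √g e^{2σ/x} N² ≤ ∫ √g e^{2σ/x} x⁴ |∇N|²`. [cite: ChruscielDelay2003, Thm. 5.9 (proof), Prop. C.4] -/
theorem IsMetricOn.integral_N_sq_le (hG : IsMetricOn G V)
    (hpos : ∀ y ∈ V, ∀ e : E, e ≠ 0 → 0 < G y e e) (hxf : ContDiffOn ℝ ∞ xf V)
    {x₁ m M : ℝ} (hx₁ : 0 < x₁) (hm : 0 < m) (hM : 0 ≤ M)
    (hgrad : ∀ y ∈ V, 0 < xf y → xf y < x₁ → m ≤ gradSqAt G xf y)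
    (hlap : ∀ y ∈ V, 0 < xf y → xf y < x₁ → |lapAt G xf y| ≤ M) {σ : ℝ} (hσ : 0 < σ) :
    ∃ x₂ : ℝ, 0 < x₂ ∧ ∀ x₀ : ℝ, x₀ ≤ x₂ → x₀ ≤ x₁ → ∀ N : E → ℝ, ContDiffOn ℝ ∞ N V →
      HasCompactSupport N → tsupport N ⊆ {y ∈ V | 0 < xf y ∧ xf y < x₀} →
      (σ ^ 2 / 2 * m) * ∫ y, sqrtDetGram G b y * (Real.exp (2 * σ / xf y) * N y ^ 2) ∂μ ≤
        ∫ y, sqrtDetGram G b y * (Real.exp (2 * σ / xf y) * xf y ^ 4 * gradSqAt G N y) ∂μ := by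
  have hε : (0 : ℝ) < σ ^ 2 / 2 := by positivity
  obtain ⟨x₂, hx₂, hC4⟩ := hG.integral_weightedPoincare_boundary b μ hpos hxf hx₁ hm hM hgrad hlap
    (-σ) 2 hε
  refine ⟨x₂, hx₂, fun x₀ hx₀ hx₀x₁ N hN hNs hNS ↦ ?_⟩
  have hNS₂ : tsupport N ⊆ {y ∈ V | 0 < xf y ∧ xf y < x₂} := fun y hy ↦
    ⟨(hNS hy).1, (hNS hy).2.1, (hNS hy).2.2.trans_le hx₀⟩
  have h := hC4 N hN hNs hNS₂
  have hs : (-σ) ^ 2 - σ ^ 2 / 2 = σ ^ 2 / 2 := by ring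
  rw [hs] at h
  -- the collar
  set W : Set E := {y ∈ V | 0 < xf y ∧ xf y < x₁} with hWdef
  have hGW : IsMetricOn G W := hG.collar hxf x₁
  have hSW : tsupport N ⊆ W := fun y hy ↦ ⟨(hNS hy).1, (hNS hy).2.1, (hNS hy).2.2.trans_le hx₀x₁⟩
  have hWV : W ⊆ V := fun y hy ↦ hy.1
  have hNW := hN.mono hWV
  have hxfW := hxf.mono hWV
  have hne : ∀ y ∈ W, xf y ≠ 0 := fun y hy ↦ hy.2.1.ne'
  have hE := contDiffOn_expWeight_collar (V := V) hxf σ x₁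
  have hE' : ContDiffOn ℝ ∞ (fun y ↦ Real.exp (2 * (-(-σ) / xf y + 2 * Real.log (xf y)))) W := by
    have h1 : ContDiffOn ℝ ∞ (fun y ↦ (xf y)⁻¹) W := hxfW.inv hne
    have h2 : ContDiffOn ℝ ∞ (fun y ↦ Real.log (xf y)) W := hxfW.log hne
    have h3 : ContDiffOn ℝ ∞ (fun y ↦ -(-σ) / xf y + 2 * Real.log (xf y)) W := by
      refine ((h1.const_smul (-(-σ))).add (h2.const_smul (2 : ℝ))).congr fun y _ ↦ ?_
      simp only [smul_eq_mul, div_eq_mul_inv]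
    exact (contDiffOn_const.mul h3).exp
  have hN0 : ∀ z ∉ tsupport N, N z = 0 ∧ fderiv ℝ N z = 0 := fun z hz ↦
    (eventually_eq_zero_and_fderiv_eq_zero hz).self_of_nhds
  -- `m e N² ≤ e' (|∇x|²/x⁴) N²` pointwise, and `e' |∇N|² = e x⁴ |∇N|²`
  have hI₁ := hG.integrable_collar b μ hpos hxf hNs (isClosed_tsupport N) hSW
    ((hE.mul (hNW.pow 2)).const_smul m |>.congr fun y _ ↦ by simp only [smul_eq_mul]; rfl)
    fun z hz ↦ by simp [(hN0 z hz).1]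
  have hI₂ := hG.integrable_collar b μ hpos hxf hNs (isClosed_tsupport N) hSW
    ((hE'.mul ((hGW.contDiffOn_gradSqAt hxfW).div (hxfW.pow 4) fun y hy ↦ pow_ne_zero 4 (hne y hy))).mul
      (hNW.pow 2)) fun z hz ↦ by simp [(hN0 z hz).1]
  have hmono : ∫ y, sqrtDetGram G b y * (m * (Real.exp (2 * σ / xf y) * N y ^ 2)) ∂μ ≤
      ∫ y, sqrtDetGram G b y * (Real.exp (2 * (-(-σ) / xf y + 2 * Real.log (xf y)))
        * (gradSqAt G xf y / xf y ^ 4) * N y ^ 2) ∂μ := by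
    refine integral_mono hI₁ hI₂ fun y ↦ ?_
    show sqrtDetGram G b y * (m * (Real.exp (2 * σ / xf y) * N y ^ 2)) ≤ sqrtDetGram G b y *
      (Real.exp (2 * (-(-σ) / xf y + 2 * Real.log (xf y))) * (gradSqAt G xf y / xf y ^ 4) * N y ^ 2)
    by_cases hy : y ∈ tsupport N
    · obtain ⟨hyV, hx, hxx₀⟩ := hNS hy
      have hg := hgrad y hyV hx (hxx₀.trans_le hx₀x₁)
      rw [cdWeight_negneg_eq σ hx]
      refine mul_le_mul_of_nonneg_left ?_ (Real.sqrt_nonneg _)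
      have hx4 : xf y ^ 4 ≠ 0 := pow_ne_zero 4 hx.ne'
      have : Real.exp (2 * σ / xf y) * xf y ^ 4 * (gradSqAt G xf y / xf y ^ 4) * N y ^ 2 =
          gradSqAt G xf y * (Real.exp (2 * σ / xf y) * N y ^ 2) := by field_simp
      rw [this]
      exact mul_le_mul_of_nonneg_right hg (by positivity)
    · simp [(hN0 y hy).1]
  have hrhs : ∫ y, sqrtDetGram G b y * (Real.exp (2 * (-(-σ) / xf y + 2 * Real.log (xf y)))
      * gradSqAt G N y) ∂μ =
      ∫ y, sqrtDetGram G b y * (Real.exp (2 * σ / xf y) * xf y ^ 4 * gradSqAt G N y) ∂μ := by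
    refine integral_congr_ae (Eventually.of_forall fun y ↦ ?_)
    show sqrtDetGram G b y * _ = sqrtDetGram G b y * _
    by_cases hy : y ∈ tsupport N
    · rw [cdWeight_negneg_eq σ (hNS hy).2.1]
    · simp [gradSqAt_apply, (hN0 y hy).2]
  have hlhs : ∫ y, sqrtDetGram G b y * (m * (Real.exp (2 * σ / xf y) * N y ^ 2)) ∂μ =
      m * ∫ y, sqrtDetGram G b y * (Real.exp (2 * σ / xf y) * N y ^ 2) ∂μ := by
    rw [← integral_const_mul]
    exact integral_congr_ae (Eventually.of_forall fun y ↦ by ring)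
  rw [hrhs] at h
  rw [hlhs] at hmono
  have := mul_le_mul_of_nonneg_left hmono hε.le
  calc σ ^ 2 / 2 * m * ∫ y, sqrtDetGram G b y * (Real.exp (2 * σ / xf y) * N y ^ 2) ∂μ
      = σ ^ 2 / 2 * (m * ∫ y, sqrtDetGram G b y * (Real.exp (2 * σ / xf y) * N y ^ 2) ∂μ) := by ring
    _ ≤ _ := this
    _ ≤ _ := h

/-! ### (IV) `(σ²m/2) ∫e x⁴|∇N|² ≤ 4 ∫e x⁸|Hess N|²` -/

/-- **(IV)** (the Hessian estimate with `s = −σ`, `t = 2`, `ε = σ²/2`): under the same collar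
bounds there is `x₂ > 0` such that for `x₀ ≤ min x₂ x₁` and every `N` smooth on `V` with compact
support in `{0 < x < x₀}`, `(σ²m/2) ∫ √g e^{2σ/x} x⁴|∇N|² ≤ 4 ∫ √g e^{2σ/x} x⁸ |Hess N|²`.
[cite: ChruscielDelay2003, Thm. 5.9 (proof), Prop. C.4] -/
theorem IsMetricOn.integral_gradN_le (hG : IsMetricOn G V)
    (hpos : ∀ y ∈ V, ∀ e : E, e ≠ 0 → 0 < G y e e) (hxf : ContDiffOn ℝ ∞ xf V)
    {x₁ m M : ℝ} (hx₁ : 0 < x₁) (hm : 0 < m) (hM : 0 ≤ M)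
    (hgrad : ∀ y ∈ V, 0 < xf y → xf y < x₁ → m ≤ gradSqAt G xf y)
    (hlap : ∀ y ∈ V, 0 < xf y → xf y < x₁ → |lapAt G xf y| ≤ M) {σ : ℝ} (hσ : 0 < σ) :
    ∃ x₂ : ℝ, 0 < x₂ ∧ ∀ x₀ : ℝ, x₀ ≤ x₂ → x₀ ≤ x₁ → ∀ N : E → ℝ, ContDiffOn ℝ ∞ N V →
      HasCompactSupport N → tsupport N ⊆ {y ∈ V | 0 < xf y ∧ xf y < x₀} →
      (σ ^ 2 / 2 * m) * ∫ y, sqrtDetGram G b y *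
          (Real.exp (2 * σ / xf y) * xf y ^ 4 * gradSqAt G N y) ∂μ ≤
        4 * ∫ y, sqrtDetGram G b y * (Real.exp (2 * σ / xf y) * xf y ^ 8
          * normSqAt G y (hessAt G N y)) ∂μ := by
  have hε : (0 : ℝ) < σ ^ 2 / 2 := by positivity
  have hsε : σ ^ 2 / 2 < (-σ) ^ 2 := by nlinarith
  obtain ⟨x₂, hx₂, hH⟩ := hG.integral_weightedHessian_boundary b μ hpos hxf hx₁ hm hM hgrad hlap
    (-σ) 2 hε hsε
  refine ⟨x₂, hx₂, fun x₀ hx₀ hx₀x₁ N hN hNs hNS ↦ ?_⟩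
  have hNS₂ : tsupport N ⊆ {y ∈ V | 0 < xf y ∧ xf y < x₂} := fun y hy ↦
    ⟨(hNS hy).1, (hNS hy).2.1, (hNS hy).2.2.trans_le hx₀⟩
  have h := hH N hN hNs hNS₂
  have hs : (-σ) ^ 2 - σ ^ 2 / 2 = σ ^ 2 / 2 := by ring
  rw [hs] at h
  set W : Set E := {y ∈ V | 0 < xf y ∧ xf y < x₁} with hWdef
  have hGW : IsMetricOn G W := hG.collar hxf x₁
  have hSW : tsupport N ⊆ W := fun y hy ↦ ⟨(hNS hy).1, (hNS hy).2.1, (hNS hy).2.2.trans_le hx₀x₁⟩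
  have hWV : W ⊆ V := fun y hy ↦ hy.1
  have hNW := hN.mono hWV
  have hxfW := hxf.mono hWV
  have hne : ∀ y ∈ W, xf y ≠ 0 := fun y hy ↦ hy.2.1.ne'
  have hE := contDiffOn_expWeight_collar (V := V) hxf σ x₁
  have hE' : ContDiffOn ℝ ∞ (fun y ↦ Real.exp (2 * (-(-σ) / xf y + 2 * Real.log (xf y)))) W := by
    have h1 : ContDiffOn ℝ ∞ (fun y ↦ (xf y)⁻¹) W := hxfW.inv hne
    have h2 : ContDiffOn ℝ ∞ (fun y ↦ Real.log (xf y)) W := hxfW.log hne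
    have h3 : ContDiffOn ℝ ∞ (fun y ↦ -(-σ) / xf y + 2 * Real.log (xf y)) W := by
      refine ((h1.const_smul (-(-σ))).add (h2.const_smul (2 : ℝ))).congr fun y _ ↦ ?_
      simp only [smul_eq_mul, div_eq_mul_inv]
    exact (contDiffOn_const.mul h3).exp
  have hN0 : ∀ z ∉ tsupport N, N z = 0 ∧ fderiv ℝ N z = 0 := fun z hz ↦
    (eventually_eq_zero_and_fderiv_eq_zero hz).self_of_nhds
  have hg0 : ∀ z ∉ tsupport N, gradSqAt G N z = 0 := fun z hz ↦ by
    rw [gradSqAt_apply, (hN0 z hz).2]; rfl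
  have hI₁ := hG.integrable_collar b μ hpos hxf hNs (isClosed_tsupport N) hSW
    (((hE.mul (hxfW.pow 4)).mul (hGW.contDiffOn_gradSqAt hNW)).const_smul m |>.congr
      fun y _ ↦ by simp only [smul_eq_mul]; rfl) fun z hz ↦ by simp [hg0 z hz]
  have hI₂ := hG.integrable_collar b μ hpos hxf hNs (isClosed_tsupport N) hSW
    ((hE'.mul (hGW.contDiffOn_gradSqAt hxfW)).mul (hGW.contDiffOn_gradSqAt hNW))
    fun z hz ↦ by simp [hg0 z hz]
  have hmono : ∫ y, sqrtDetGram G b y * (m * (Real.exp (2 * σ / xf y) * xf y ^ 4 * gradSqAt G N y)) ∂μ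
      ≤ ∫ y, sqrtDetGram G b y * (Real.exp (2 * (-(-σ) / xf y + 2 * Real.log (xf y)))
        * gradSqAt G xf y * gradSqAt G N y) ∂μ := by
    refine integral_mono hI₁ hI₂ fun y ↦ ?_
    show sqrtDetGram G b y * (m * (Real.exp (2 * σ / xf y) * xf y ^ 4 * gradSqAt G N y)) ≤
      sqrtDetGram G b y * (Real.exp (2 * (-(-σ) / xf y + 2 * Real.log (xf y)))
        * gradSqAt G xf y * gradSqAt G N y)
    by_cases hy : y ∈ tsupport N
    · obtain ⟨hyV, hx, hxx₀⟩ := hNS hy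
      have hg := hgrad y hyV hx (hxx₀.trans_le hx₀x₁)
      have hgN : 0 ≤ gradSqAt G N y := by
        have hi := hG.isInvertible y hyV
        rw [gradSqAt_apply, ← apply_sharpAt_apply hi]
        by_cases hz : sharpAt G y (fderiv ℝ N y) = 0
        · simp [hz]
        · exact (hpos y hyV _ hz).le
      rw [cdWeight_negneg_eq σ hx]
      refine mul_le_mul_of_nonneg_left ?_ (Real.sqrt_nonneg _)
      have : Real.exp (2 * σ / xf y) * xf y ^ 4 * gradSqAt G xf y * gradSqAt G N y =
          gradSqAt G xf y * (Real.exp (2 * σ / xf y) * xf y ^ 4 * gradSqAt G N y) := by ring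
      rw [this]
      exact mul_le_mul_of_nonneg_right hg (by positivity)
    · simp [hg0 y hy]
  have hrhs : ∫ y, sqrtDetGram G b y * (Real.exp (2 * (-(-σ) / xf y + 2 * Real.log (xf y)))
      * xf y ^ 4 * normSqAt G y (hessAt G N y)) ∂μ =
      ∫ y, sqrtDetGram G b y * (Real.exp (2 * σ / xf y) * xf y ^ 8
        * normSqAt G y (hessAt G N y)) ∂μ := by
    refine integral_congr_ae (Eventually.of_forall fun y ↦ ?_)
    show sqrtDetGram G b y * _ = sqrtDetGram G b y * _
    by_cases hy : y ∈ tsupport N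
    · rw [cdWeight_negneg_eq σ (hNS hy).2.1]; ring
    · have hNy : N =ᶠ[𝓝 y] fun _ ↦ 0 := notMem_tsupport_iff_eventuallyEq.mp hy
      have hh : hessAt G N y = 0 := by
        rw [hessAt_congr_of_eventuallyEq G hNy]; ext v w; simp [hessAt_apply]
      simp [hh, normSqAt_eq_traceCLM]
  have hlhs : ∫ y, sqrtDetGram G b y * (m * (Real.exp (2 * σ / xf y) * xf y ^ 4 * gradSqAt G N y)) ∂μ
      = m * ∫ y, sqrtDetGram G b y * (Real.exp (2 * σ / xf y) * xf y ^ 4 * gradSqAt G N y) ∂μ := by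
    rw [← integral_const_mul]
    exact integral_congr_ae (Eventually.of_forall fun y ↦ by ring)
  rw [hrhs] at h
  rw [hlhs] at hmono
  have := mul_le_mul_of_nonneg_left hmono hε.le
  calc σ ^ 2 / 2 * m * ∫ y, sqrtDetGram G b y *
        (Real.exp (2 * σ / xf y) * xf y ^ 4 * gradSqAt G N y) ∂μ
      = σ ^ 2 / 2 * (m * ∫ y, sqrtDetGram G b y *
          (Real.exp (2 * σ / xf y) * xf y ^ 4 * gradSqAt G N y) ∂μ) := by ring
    _ ≤ _ := this
    _ ≤ _ := h

/-! ### (VII) `∫e x⁴|∇Y|² ≤ 4 ∫e x⁴|S(Y)|² + 2(3(σ+2)²M₁ + ρ) ∫e|Y|²` -/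

/-- The profile `g(r) = σ/r + 2 log r`: derivative on `r > 0`. [folklore] -/
private theorem hasDerivAt_kornWeight (σ : ℝ) {r : ℝ} (hr : 0 < r) :
    HasDerivAt (fun r ↦ σ / r + 2 * Real.log r) (-σ / r ^ 2 + 2 / r) r := by
  have h1 : HasDerivAt (fun r : ℝ ↦ r⁻¹) (-(r ^ 2)⁻¹) r := hasDerivAt_inv hr.ne'
  have h2 : HasDerivAt Real.log r⁻¹ r := Real.hasDerivAt_log hr.ne'
  have h := ((h1.const_mul σ).fun_add (h2.const_mul 2)).congr_deriv
    (g' := -σ / r ^ 2 + 2 / r) (by field_simp)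
  refine h.congr_of_eventuallyEq (Eventually.of_forall fun ρ ↦ ?_)
  simp only [div_eq_mul_inv]

/-- **(VII)** (the weighted Korn inequality with `e^{2u} = e^{2σ/x}x⁴`): if `Ric(v,v) ≤ ρ|v|²` and
`|∇x|² ≤ M₁` on `{0 < x < x₁}` (`ρ, σ ≥ 0`), then for every `Y` smooth on `V` with compact support in
`{0 < x < x₀}`, `x₀ ≤ min 1 x₁`,
`∫ √g e x⁴|∇Y|² ≤ 4 ∫ √g e x⁴|S(Y)|² + 2(3(σ+2)²M₁ + ρ) ∫ √g e|Y|²` (`e = e^{2σ/x}`).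
[cite: ChruscielDelay2003, §2 (2.14), Thm. 5.9 (proof)] -/
theorem IsMetricOn.integral_gradY_le (hG : IsMetricOn G V)
    (hpos : ∀ y ∈ V, ∀ e : E, e ≠ 0 → 0 < G y e e) (hxf : ContDiffOn ℝ ∞ xf V)
    {x₁ x₀ ρ M₁ σ : ℝ} (hx₀1 : x₀ ≤ 1) (hx₀x₁ : x₀ ≤ x₁) (hσ : 0 ≤ σ) (hρ : 0 ≤ ρ)
    (hric : ∀ y ∈ V, 0 < xf y → xf y < x₁ → ∀ v : E, ricAt G y v v ≤ ρ * G y v v)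
    (hgradU : ∀ y ∈ V, 0 < xf y → xf y < x₁ → gradSqAt G xf y ≤ M₁)
    (hY : ContDiffOn ℝ ∞ Y V) (hYs : HasCompactSupport Y)
    (hYS : tsupport Y ⊆ {y ∈ V | 0 < xf y ∧ xf y < x₀}) :
    ∫ y, sqrtDetGram G b y * (Real.exp (2 * σ / xf y) * xf y ^ 4
        * mtrAt G y ((G y).bilinearComp (covDAt G Y y) (covDAt G Y y))) ∂μ ≤
      4 * ∫ y, sqrtDetGram G b y * (Real.exp (2 * σ / xf y) * xf y ^ 4
          * normSqAt G y (symAt ((G y).comp (covDAt G Y y)))) ∂μ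
        + 2 * (3 * (σ + 2) ^ 2 * M₁ + ρ)
          * ∫ y, sqrtDetGram G b y * (Real.exp (2 * σ / xf y) * G y (Y y) (Y y)) ∂μ := by
  set W : Set E := {y ∈ V | 0 < xf y ∧ xf y < x₁} with hWdef
  have hGW : IsMetricOn G W := hG.collar hxf x₁
  have hposW : ∀ y ∈ W, ∀ e : E, e ≠ 0 → 0 < G y e e := fun y hy ↦ hpos y hy.1
  have hSW : tsupport Y ⊆ W := fun y hy ↦ ⟨(hYS hy).1, (hYS hy).2.1, (hYS hy).2.2.trans_le hx₀x₁⟩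
  have hWV : W ⊆ V := fun y hy ↦ hy.1
  have hYW := hY.mono hWV
  have hxfW := hxf.mono hWV
  have hne : ∀ y ∈ W, xf y ≠ 0 := fun y hy ↦ hy.2.1.ne'
  have hρW : ∀ y ∈ W, ∀ v : E, ricAt G y v v ≤ ρ * G y v v := fun y hy ↦ hric y hy.1 hy.2.1 hy.2.2
  -- the weight `u = σ/x + 2 log x`
  set u : E → ℝ := fun y ↦ σ / xf y + 2 * Real.log (xf y) with hudef
  have hu : ContDiffOn ℝ ∞ u W := by
    have h1 : ContDiffOn ℝ ∞ (fun y ↦ (xf y)⁻¹) W := hxfW.inv hne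
    have h2 : ContDiffOn ℝ ∞ (fun y ↦ Real.log (xf y)) W := hxfW.log hne
    refine ((h1.const_smul σ).add (h2.const_smul (2 : ℝ))).congr fun y _ ↦ ?_
    simp only [hudef, smul_eq_mul, div_eq_mul_inv]
  have hK := hGW.integral_weightedKornGradient b μ hposW hu hρW hYW hYs hSW
  -- off the support
  have hY0 : ∀ z ∉ tsupport Y, Y z = 0 ∧ covDAt G Y z = 0 := by
    intro z hz
    have hYz : Y =ᶠ[𝓝 z] fun _ ↦ 0 := notMem_tsupport_iff_eventuallyEq.mp hz
    refine ⟨hYz.self_of_nhds, ?_⟩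
    ext e
    simp only [covDAt_apply, hYz.self_of_nhds, hYz.fderiv_eq, fderiv_fun_const, map_zero,
      _root_.zero_apply, add_zero, Pi.zero_apply]
  have hmtr0 : ∀ z, mtrAt G z (0 : E →L[ℝ] E →L[ℝ] ℝ) = 0 :=
    fun z ↦ by rw [mtrAt_eq_sum b]; simp
  have hs0 : symAt (0 : E →L[ℝ] E →L[ℝ] ℝ) = 0 := by ext v w; simp [symAt_apply]
  -- the weights agree on the support
  have hwt : ∀ y ∈ tsupport Y, Real.exp (2 * u y) = Real.exp (2 * σ / xf y) * xf y ^ 4 :=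
    fun y hy ↦ cdWeight_exp_eq σ (hYS hy).2.1
  have hlhs : ∫ y, sqrtDetGram G b y * (Real.exp (2 * u y)
      * mtrAt G y ((G y).bilinearComp (covDAt G Y y) (covDAt G Y y))) ∂μ =
      ∫ y, sqrtDetGram G b y * (Real.exp (2 * σ / xf y) * xf y ^ 4
        * mtrAt G y ((G y).bilinearComp (covDAt G Y y) (covDAt G Y y))) ∂μ := by
    refine integral_congr_ae (Eventually.of_forall fun y ↦ ?_)
    show sqrtDetGram G b y * _ = sqrtDetGram G b y * _
    by_cases hy : y ∈ tsupport Y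
    · rw [hwt y hy]
    · simp [(hY0 y hy).2, hmtr0]
  have hrhs₁ : ∫ y, sqrtDetGram G b y * (Real.exp (2 * u y)
      * normSqAt G y (symAt ((G y).comp (covDAt G Y y)))) ∂μ =
      ∫ y, sqrtDetGram G b y * (Real.exp (2 * σ / xf y) * xf y ^ 4
        * normSqAt G y (symAt ((G y).comp (covDAt G Y y)))) ∂μ := by
    refine integral_congr_ae (Eventually.of_forall fun y ↦ ?_)
    show sqrtDetGram G b y * _ = sqrtDetGram G b y * _
    by_cases hy : y ∈ tsupport Y
    · rw [hwt y hy]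
    · rw [(hY0 y hy).2, ContinuousLinearMap.comp_zero, hs0]
      simp [normSqAt_eq_traceCLM]
  -- the lower-order term: `e^{2u}(3|∇u|² + ρ)|Y|² ≤ (3(σ+2)²M₁ + ρ) e |Y|²`
  have hnYW : ContDiffOn ℝ ∞ (fun y ↦ G y (Y y) (Y y)) W := (hGW.contDiffOn.clm_apply hYW).clm_apply hYW
  have hE := contDiffOn_expWeight_collar (V := V) hxf σ x₁
  have hk₁ : ContDiffOn ℝ ∞ (fun y ↦ Real.exp (2 * u y)
      * ((3 * gradSqAt G u y + ρ) * G y (Y y) (Y y))) W :=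
    (contDiffOn_const.mul hu).exp.mul
      (((contDiffOn_const.mul (hGW.contDiffOn_gradSqAt hu)).add contDiffOn_const).mul hnYW)
  have hk₂ : ContDiffOn ℝ ∞ (fun y ↦ (3 * (σ + 2) ^ 2 * M₁ + ρ)
      * (Real.exp (2 * σ / xf y) * G y (Y y) (Y y))) W :=
    contDiffOn_const.mul (hE.mul hnYW)
  have hI₁ := hG.integrable_collar b μ hpos hxf hYs (isClosed_tsupport Y) hSW hk₁
    fun z hz ↦ by simp [(hY0 z hz).1]
  have hI₂ := hG.integrable_collar b μ hpos hxf hYs (isClosed_tsupport Y) hSW hk₂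
    fun z hz ↦ by simp [(hY0 z hz).1]
  have hlow : ∫ y, sqrtDetGram G b y * (Real.exp (2 * u y)
      * ((3 * gradSqAt G u y + ρ) * G y (Y y) (Y y))) ∂μ ≤
      ∫ y, sqrtDetGram G b y * ((3 * (σ + 2) ^ 2 * M₁ + ρ)
        * (Real.exp (2 * σ / xf y) * G y (Y y) (Y y))) ∂μ := by
    refine integral_mono hI₁ hI₂ fun y ↦ ?_
    show sqrtDetGram G b y * (Real.exp (2 * u y) * ((3 * gradSqAt G u y + ρ) * G y (Y y) (Y y))) ≤
      sqrtDetGram G b y * ((3 * (σ + 2) ^ 2 * M₁ + ρ) * (Real.exp (2 * σ / xf y) * G y (Y y) (Y y)))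
    by_cases hy : y ∈ tsupport Y
    · obtain ⟨hyV, hx, hxx₀⟩ := hYS hy
      have hx1 : xf y ≤ 1 := hxx₀.le.trans hx₀1
      have hxx₁ := hxx₀.trans_le hx₀x₁
      have hnY : 0 ≤ G y (Y y) (Y y) := by
        by_cases hz : Y y = 0
        · simp [hz]
        · exact (hpos y hyV _ hz).le
      have hg2 : 0 ≤ gradSqAt G xf y := by
        have hi := hG.isInvertible y hyV
        rw [gradSqAt_apply, ← apply_sharpAt_apply hi]
        by_cases hz : sharpAt G y (fderiv ℝ xf y) = 0
        · simp [hz]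
        · exact (hpos y hyV _ hz).le
      have hxd : DifferentiableAt ℝ xf y :=
        ((hxf y hyV).contDiffAt (hG.mem_nhds hyV)).differentiableAt (by simp)
      have hgu : gradSqAt G u y = (-σ / xf y ^ 2 + 2 / xf y) ^ 2 * gradSqAt G xf y := by
        have hd := hasDerivAt_kornWeight σ hx
        rw [show u = fun z ↦ (fun r ↦ σ / r + 2 * Real.log r) (xf z) from rfl,
          gradSqAt_comp_of_differentiableAt hd.differentiableAt hxd, hd.deriv]
      rw [hwt y hy, hgu]
      refine mul_le_mul_of_nonneg_left ?_ (Real.sqrt_nonneg _)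
      -- `x⁴ (−σ/x² + 2/x)² = (2x − σ)² ≤ (σ+2)²`, `x⁴ ρ ≤ ρ`
      have hX := hx
      set X := xf y with hXdef
      have hkey : X ^ 4 * (3 * ((-σ / X ^ 2 + 2 / X) ^ 2 * gradSqAt G xf y) + ρ) ≤
          3 * (σ + 2) ^ 2 * M₁ + ρ := by
        have h1 : X ^ 4 * (-σ / X ^ 2 + 2 / X) ^ 2 = (2 * X - σ) ^ 2 := by
          field_simp
          ring
        have h2 : (2 * X - σ) ^ 2 ≤ (σ + 2) ^ 2 := by nlinarith
        have h3 : X ^ 4 ≤ 1 := pow_le_one₀ hX.le hx1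
        have hgM := hgradU y hyV hx hxx₁
        calc X ^ 4 * (3 * ((-σ / X ^ 2 + 2 / X) ^ 2 * gradSqAt G xf y) + ρ)
            = 3 * (X ^ 4 * (-σ / X ^ 2 + 2 / X) ^ 2) * gradSqAt G xf y + X ^ 4 * ρ := by ring
          _ = 3 * (2 * X - σ) ^ 2 * gradSqAt G xf y + X ^ 4 * ρ := by rw [h1]
          _ ≤ 3 * (σ + 2) ^ 2 * M₁ + 1 * ρ := by
              gcongr
          _ = 3 * (σ + 2) ^ 2 * M₁ + ρ := by ring
      calc Real.exp (2 * σ / X) * X ^ 4 * ((3 * ((-σ / X ^ 2 + 2 / X) ^ 2 * gradSqAt G xf y) + ρ)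
            * G y (Y y) (Y y))
          = (X ^ 4 * (3 * ((-σ / X ^ 2 + 2 / X) ^ 2 * gradSqAt G xf y) + ρ))
            * (Real.exp (2 * σ / X) * G y (Y y) (Y y)) := by ring
        _ ≤ (3 * (σ + 2) ^ 2 * M₁ + ρ) * (Real.exp (2 * σ / X) * G y (Y y) (Y y)) :=
            mul_le_mul_of_nonneg_right hkey (by positivity)
    · simp [(hY0 y hy).1]
  have hlow' : ∫ y, sqrtDetGram G b y * ((3 * (σ + 2) ^ 2 * M₁ + ρ)
      * (Real.exp (2 * σ / xf y) * G y (Y y) (Y y))) ∂μ =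
      (3 * (σ + 2) ^ 2 * M₁ + ρ) * ∫ y, sqrtDetGram G b y * (Real.exp (2 * σ / xf y) * G y (Y y) (Y y)) ∂μ := by
    rw [← integral_const_mul]
    exact integral_congr_ae (Eventually.of_forall fun y ↦ by ring)
  rw [hlhs, hrhs₁] at hK
  rw [hlow'] at hlow
  linarith

end Collar

end MetricCoord

end Literature.Geometry.Lorentzian

end
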